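import Summits.CriticalPhenomena.PercolationContinuityZ3.Theorems.PercNearOneGluingNoHeavyLowerTailSahiGridPatternLiteralTwoGood
import Summits.CriticalPhenomena.PercolationContinuityZ3.Theorems.PercNearOneGluingNoHeavyLowerTailSahiGridPatternDiagCert
import Summits.CriticalPhenomena.PercolationContinuityZ3.Theorems.PercNearOneGluingNoHeavyLowerTailSahiGridPatternKleitman

/-!
# `NoHeavyLowerTail` (crux stmt-CriticalPhenomena-4575), Sahi programme P1: **THE ONE-AXIS CYLINDER IDENTITY** —
# `sStarD([3] × V; B, C) = 2·Σ_s λ_V(B_s ∩ C_s) − Σ_{s ≠ t} Θ_V(B_s × C_t)`, every dimension, and the corner bound for the cylinder step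

Support file (Sahi cell, seat `prim-sahi-p1`, generation 28; `--supports stmt-CriticalPhenomena-4575`).  Pure proofs, no definitions, no
`sorry`, standard axioms.  Vocabulary of `…SahiGridPattern{,CellForm,SliceForm,RectCert,LiteralTwoGood}` (`Pd`, `sStarD`, `glue`, `sect`,
`ind`, `TotDist`, `thirdPt`, `lamU`, `thetaVal`).

THE MATHEMATICS.  Let `V ⊆ [3]^k` be ANY finset and `A = [3] × V ⊆ [3]^{1+k}` the cylinder with one free axis in front
(`glue ξ z ∈ A ↔ z ∈ V`); for `B, C ⊆ [3]^{1+k}` write `B_s = sect B s`, `C_t = sect C t` (`s, t ∈ [3]`) for the sections along the free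
axis, `λ_V(W) = Σ_{q ∈ W} λ_V(q)` (`lamU`, `λ_V(q) = 2^{k+1}·1_V(q) − ν_V(q)`) and `Θ_V(P × Q) = Σ_{q ∈ P, r ∈ Q} Θ_V(q,r)` (`thetaVal`,
`Θ_V(q,r) = [q δ̸ r](1_V(q) + 1_V(r) − 1_V(q̄r))`), so that `sStarD V P Q = λ_V(P ∩ Q) − Θ_V(P × Q)` (`sStarD_eq_sum_lamU_sub_sum_thetaVal`).
* **`sStarD_cylOne_eq_lamU_sub_thetaVal`** (EXACT IDENTITY, arbitrary finsets `V, B, C`, every `k`):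
    `sStarD A B C = 2·Σ_{s} λ_V(B_s ∩ C_s) − Σ_{s ≠ t} Θ_V(B_s × C_t)`.
  The DIAGONAL rectangles `Θ_V(B_s × C_s)` cancel exactly; the cylinder sees `V` only through the diagonal `λ`-masses and the six
  OFF-DIAGONAL rectangles.  (Proof: the 30-term one-axis kernel `sStarD_eq_pd1_sections`, symmetrised in the inner pair `(q,r)`, is a
  polynomial identity.)  Equivalent atom form **`sStarD_cylOne_eq_atoms`**:
    `sStarD A B C = 2·Σ_s sStarD V B_s C_s + Σ_{s<t} Σ_{q δ̸ r} (1_{B_t} − 1_{B_s})(q)·(1_{C_t} − 1_{C_s})(r)·(1_V(q) + 1_V(r) − 1_V(q̄r))`,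
  i.e. `Θ_V` evaluated on the INCREMENT rectangles `(B_t − B_s) ⊗ (C_t − C_s)`.
* **`sStarD_cylOne_ge_of_good`** (THE CORNER BOUND): if `V` is a good first slot of `[3]^k` (`0 ≤ sStarD V P Q` for all up-sets `P, Q`)
  and `B, C` are up-sets, then goodness at the six off-diagonal section pairs gives
    `sStarD A B C ≥ 2·Σ_s λ_V(B_s ∩ C_s) − Σ_{s≠t} λ_V(B_s ∩ C_t) = Σ_{s<t} Σ_q (1_{B_t} − 1_{B_s})(q)(1_{C_t} − 1_{C_s})(q)·λ_V(q)`
  (`two_mul_sum_lamU_sub_eq_corners`, pure modularity) — the `λ_V`-mass of the three CORNER sets `E_{st} = (B_t ∖ B_s) ∩ (C_t ∖ C_s)`.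
  Since `λ_V ≥ 2^k > 0` on `V` and `λ_V = −ν_V ≤ 0` off `V`, the cylinder over a merely GOOD `V` can fail to be good only through the
  td-shadow `ν_V` of `V` on corner points OUTSIDE `V`: **`sStarD_cylOne_nonneg_of_good_of_corners`** — if every corner point lies in `V`
  (`glue t q ∈ B ∩ C`, `glue s q ∉ B`, `glue s q ∉ C`, `s < t` ⟹ `q ∈ V`), the cylinder is a good triple `(A,B,C)`.  (When `B` or `C`
  is itself a cylinder the corners are empty: the block-restriction theorem of `…SahiGridPatternTwoCylinders` is recovered.)
WHY IT MATTERS (seat memo FROM-prim-sahi-p1-gen28, §3): "good in dimension `k` ⟹ cylinder good in dimension `k+1`" (cylinder closure) is the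
simplest step of the read-once programme that has NO kernel certificate in any typed dictionary (LP, this generation: residual exactly `2` on
the constant monomial, unchanged by lattice-word atoms); the identity isolates the obstruction as the corner `ν`-shadow, and with a DIAGONAL
CERTIFICATE `d` of `V` (`…SahiGridPatternDiagCert`: (T) `d ≤ λ_V` on up-sets, (N) `Θ_V(P×Q) ≤ d(P∩Q)`, `d ≥ 0`) the off-diagonal rectangles are
paid by modularity of `d` — the one-axis case of `sStarD_cylSet_nonneg_of_diagCert`.
Nothing here asserts `PatternPos d` for `d ≥ 4`. [this work]
-/

namespace Summit.CriticalPhenomena.PercolationContinuityZ3.Theorems.SahiGridPattern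

open Finset SahiGrid3
open scoped BigOperators

variable {k : ℕ}

/-! ### Symmetrisation of a double sum -/

/-- If two kernels agree after symmetrisation in `(q, r)`, their double sums agree. [this work] -/
theorem sum_sum_eq_of_symm_eq {α : Type*} [Fintype α] (f g : α → α → ℤ)
    (h : ∀ q r, f q r + f r q = g q r + g r q) :
    (∑ q, ∑ r, f q r) = ∑ q, ∑ r, g q r := by
  have hf : (∑ q, ∑ r, f q r) = ∑ q, ∑ r, f r q := Finset.sum_comm
  have hg : (∑ q, ∑ r, g q r) = ∑ q, ∑ r, g r q := Finset.sum_comm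
  have h2 : (∑ q, ∑ r, (f q r + f r q)) = ∑ q, ∑ r, (g q r + g r q) :=
    Finset.sum_congr rfl fun q _ => Finset.sum_congr rfl fun r _ => h q r
  simp only [Finset.sum_add_distrib] at h2
  omega

/-- Indicator of a cylinder with one free axis in front: `1_A(glue ξ z) = 1_V(z)`. [this work] -/
theorem ind_glue_of_cyl {V : Finset (Pd k)} {A : Finset (Pd (1 + k))} (hA : ∀ ξ z, glue ξ z ∈ A ↔ z ∈ V) (ξ : Pd 1) (z : Pd k) :
    ind A (glue ξ z) = ind V z := by
  unfold ind; simp only [hA]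

/-! ### The identity, atom form -/

/-- **THE ONE-AXIS CYLINDER IDENTITY (atom form)**, arbitrary finsets `V, B, C`, every `k`: with `B_s = sect B s`, `C_s = sect C s`,
`sStarD ([3]×V) B C = 2·Σ_s sStarD V B_s C_s + Σ_{s<t} Σ_{q δ̸ r} (1_{B_t}−1_{B_s})(q)(1_{C_t}−1_{C_s})(r)(1_V(q)+1_V(r)−1_V(q̄r))`. [this work] -/
theorem sStarD_cylOne_eq_atoms (V : Finset (Pd k)) {A : Finset (Pd (1 + k))} (hA : ∀ ξ z, glue ξ z ∈ A ↔ z ∈ V)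
    (B C : Finset (Pd (1 + k))) :
    sStarD A B C =
      2 * (sStarD V (sect B (fun _ => 0)) (sect C (fun _ => 0)) + sStarD V (sect B (fun _ => 1)) (sect C (fun _ => 1))
            + sStarD V (sect B (fun _ => 2)) (sect C (fun _ => 2)))
      + ∑ q : Pd k, ∑ r : Pd k, (if TotDist q r = true then (1:ℤ) else 0) *
          ( (ind B (glue (fun _ => 1) q) - ind B (glue (fun _ => 0) q)) * (ind C (glue (fun _ => 1) r) - ind C (glue (fun _ => 0) r))
          + (ind B (glue (fun _ => 2) q) - ind B (glue (fun _ => 0) q)) * (ind C (glue (fun _ => 2) r) - ind C (glue (fun _ => 0) r))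
          + (ind B (glue (fun _ => 2) q) - ind B (glue (fun _ => 1) q)) * (ind C (glue (fun _ => 2) r) - ind C (glue (fun _ => 1) r)) )
          * (ind V q + ind V r - ind V (thirdPt q r)) := by
  rw [sStarD_eq_pd1_sections, sStarD_eq_pairSum_kernel, sStarD_eq_pairSum_kernel, sStarD_eq_pairSum_kernel]
  simp only [ind_sect, ind_glue_of_cyl hA]
  rw [show ∀ (x y z w : ℤ), 2 * (x + y + z) + w = 2 * x + 2 * y + 2 * z + w from fun x y z w => by ring]
  simp only [Finset.mul_sum, ← Finset.sum_add_distrib]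
  refine sum_sum_eq_of_symm_eq _ _ fun q r => ?_
  rw [totDist_symm r q, thirdPt_comm r q]
  split_ifs <;> ring

/-! ### The identity, `λ/Θ` form -/

/-- `λ_V(P ∩ Q)` as a totally-distinct pair sum: `Σ_{q ∈ P∩Q} λ_V(q) = Σ_{q δ̸ r} 1_P(q)1_Q(q)(2·1_V(q) − 1_V(r))`. [this work] -/
theorem sum_inter_lamU_eq_pairSum (V P Q : Finset (Pd k)) :
    (∑ q ∈ P ∩ Q, lamU V q) =
      ∑ q : Pd k, ∑ r : Pd k, (if TotDist q r = true then (1:ℤ) else 0) * (ind P q * ind Q q * (2 * ind V q - ind V r)) := by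
  rw [sum_mem_eq_sum_ind_mul]
  refine Finset.sum_congr rfl fun q _ => ?_
  rw [ind_inter_eq_mul]
  unfold lamU
  rw [nuCount_eq_sum_ind]
  have e2 : (2:ℤ) * 2 ^ k * ind V q = ∑ r : Pd k, (if TotDist q r = true then (1:ℤ) else 0) * (2 * ind V q) := by
    rw [← Finset.sum_mul, sum_ite_totDist_eq_two_pow]; ring
  have e3 : (∑ p : Pd k, ind V p * (if TotDist p q = true then (1:ℤ) else 0))
      = ∑ r : Pd k, (if TotDist q r = true then (1:ℤ) else 0) * ind V r := by
    refine Finset.sum_congr rfl fun r _ => ?_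
    rw [totDist_symm r q]; ring
  rw [e2, e3, ← Finset.sum_sub_distrib, Finset.mul_sum]
  refine Finset.sum_congr rfl fun r _ => ?_
  ring

/-- `Θ_V(P × Q)` as a totally-distinct pair sum. [this work] -/
theorem sum_sum_thetaVal_eq_pairSum (V P Q : Finset (Pd k)) :
    (∑ q ∈ P, ∑ r ∈ Q, thetaVal V q r) =
      ∑ q : Pd k, ∑ r : Pd k, (if TotDist q r = true then (1:ℤ) else 0) * (ind P q * ind Q r * (ind V q + ind V r - ind V (thirdPt q r))) := by
  rw [sum_mem_eq_sum_ind_mul]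
  refine Finset.sum_congr rfl fun q _ => ?_
  rw [sum_mem_eq_sum_ind_mul, Finset.mul_sum]
  refine Finset.sum_congr rfl fun r _ => ?_
  unfold thetaVal
  split_ifs <;> ring

/-- **THE ONE-AXIS CYLINDER IDENTITY (`λ/Θ` form)**, arbitrary finsets `V, B, C`, every `k`:
`sStarD ([3]×V) B C = 2·Σ_s λ_V(B_s ∩ C_s) − Σ_{s ≠ t} Θ_V(B_s × C_t)` — the diagonal rectangles cancel. [this work] -/
theorem sStarD_cylOne_eq_lamU_sub_thetaVal (V : Finset (Pd k)) {A : Finset (Pd (1 + k))} (hA : ∀ ξ z, glue ξ z ∈ A ↔ z ∈ V)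
    (B C : Finset (Pd (1 + k))) :
    sStarD A B C =
      2 * ((∑ q ∈ sect B (fun _ => 0) ∩ sect C (fun _ => 0), lamU V q) + (∑ q ∈ sect B (fun _ => 1) ∩ sect C (fun _ => 1), lamU V q)
            + (∑ q ∈ sect B (fun _ => 2) ∩ sect C (fun _ => 2), lamU V q))
      - ( (∑ q ∈ sect B (fun _ => 0), ∑ r ∈ sect C (fun _ => 1), thetaVal V q r) + (∑ q ∈ sect B (fun _ => 0), ∑ r ∈ sect C (fun _ => 2), thetaVal V q r)
        + (∑ q ∈ sect B (fun _ => 1), ∑ r ∈ sect C (fun _ => 0), thetaVal V q r) + (∑ q ∈ sect B (fun _ => 1), ∑ r ∈ sect C (fun _ => 2), thetaVal V q r)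
        + (∑ q ∈ sect B (fun _ => 2), ∑ r ∈ sect C (fun _ => 0), thetaVal V q r) + (∑ q ∈ sect B (fun _ => 2), ∑ r ∈ sect C (fun _ => 1), thetaVal V q r) ) := by
  rw [sStarD_eq_pd1_sections]
  simp only [sum_inter_lamU_eq_pairSum, sum_sum_thetaVal_eq_pairSum, ind_sect, ind_glue_of_cyl hA]
  rw [show ∀ (x y z a b c d e f : ℤ), 2 * (x + y + z) - (a + b + c + d + e + f) = 2 * x + 2 * y + 2 * z - a - b - c - d - e - f
    from fun x y z a b c d e f => by ring]
  simp only [Finset.mul_sum, ← Finset.sum_add_distrib, ← Finset.sum_sub_distrib]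
  refine sum_sum_eq_of_symm_eq _ _ fun q r => ?_
  rw [totDist_symm r q, thirdPt_comm r q]
  split_ifs <;> ring

/-! ### The corner bound for the cylinder step -/

/-- Goodness of `V` at a pair `(P, Q)` in `λ/Θ` form: `Θ_V(P × Q) ≤ λ_V(P ∩ Q)`. [this work] -/
theorem sum_sum_thetaVal_le_of_good {V P Q : Finset (Pd k)} (h : 0 ≤ sStarD V P Q) :
    (∑ q ∈ P, ∑ r ∈ Q, thetaVal V q r) ≤ ∑ q ∈ P ∩ Q, lamU V q := by
  rw [sStarD_eq_sum_lamU_sub_sum_thetaVal] at h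
  linarith

/-- **MODULARITY**: `2·Σ_s λ_V(B_s∩C_s) − Σ_{s≠t} λ_V(B_s∩C_t) = Σ_{s<t} Σ_q (1_{B_t}−1_{B_s})(q)(1_{C_t}−1_{C_s})(q)·λ_V(q)` for ANY six
finsets (no nesting needed: `1_{B_s}1_{C_s} + 1_{B_t}1_{C_t} − 1_{B_s}1_{C_t} − 1_{B_t}1_{C_s} = (1_{B_t}−1_{B_s})(1_{C_t}−1_{C_s})`). [this work] -/
theorem two_mul_sum_lamU_sub_eq_corners (V B0 B1 B2 C0 C1 C2 : Finset (Pd k)) :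
    2 * ((∑ q ∈ B0 ∩ C0, lamU V q) + (∑ q ∈ B1 ∩ C1, lamU V q) + (∑ q ∈ B2 ∩ C2, lamU V q))
      - ( (∑ q ∈ B0 ∩ C1, lamU V q) + (∑ q ∈ B0 ∩ C2, lamU V q) + (∑ q ∈ B1 ∩ C0, lamU V q)
        + (∑ q ∈ B1 ∩ C2, lamU V q) + (∑ q ∈ B2 ∩ C0, lamU V q) + (∑ q ∈ B2 ∩ C1, lamU V q) )
    = ∑ q : Pd k, ( (ind B1 q - ind B0 q) * (ind C1 q - ind C0 q) + (ind B2 q - ind B0 q) * (ind C2 q - ind C0 q)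
                    + (ind B2 q - ind B1 q) * (ind C2 q - ind C1 q) ) * lamU V q := by
  have e : ∀ P Q : Finset (Pd k), (∑ q ∈ P ∩ Q, lamU V q) = ∑ q : Pd k, ind P q * ind Q q * lamU V q := fun P Q => by
    rw [sum_mem_eq_sum_ind_mul]
    exact Finset.sum_congr rfl fun q _ => by rw [ind_inter_eq_mul]
  simp only [e]
  rw [show ∀ (x y z a b c d e f : ℤ), 2 * (x + y + z) - (a + b + c + d + e + f) = 2 * x + 2 * y + 2 * z - a - b - c - d - e - f
    from fun x y z a b c d e f => by ring]
  simp only [Finset.mul_sum, ← Finset.sum_add_distrib, ← Finset.sum_sub_distrib]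
  refine Finset.sum_congr rfl fun q _ => ?_
  ring

/-- **THE CORNER BOUND**: if `V` is a good first slot of `[3]^k` and `B, C ⊆ [3]^{1+k}` are up-sets, then
`sStarD ([3]×V) B C ≥ Σ_{s<t} Σ_q (1_{B_t}−1_{B_s})(q)(1_{C_t}−1_{C_s})(q)·λ_V(q)` — the `λ_V`-mass of the three corner sets
`(B_t ∖ B_s) ∩ (C_t ∖ C_s)`.  (Goodness is used only at the six off-diagonal section pairs.) [this work] -/
theorem sStarD_cylOne_ge_of_good {V : Finset (Pd k)}
    (hgood : ∀ P Q : Finset (Pd k), IsUpperSet (P : Set (Pd k)) → IsUpperSet (Q : Set (Pd k)) → 0 ≤ sStarD V P Q)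
    {A : Finset (Pd (1 + k))} (hA : ∀ ξ z, glue ξ z ∈ A ↔ z ∈ V)
    {B C : Finset (Pd (1 + k))} (hB : IsUpperSet (B : Set (Pd (1 + k)))) (hC : IsUpperSet (C : Set (Pd (1 + k)))) :
    (∑ q : Pd k, ( (ind (sect B (fun _ => 1)) q - ind (sect B (fun _ => 0)) q) * (ind (sect C (fun _ => 1)) q - ind (sect C (fun _ => 0)) q)
                 + (ind (sect B (fun _ => 2)) q - ind (sect B (fun _ => 0)) q) * (ind (sect C (fun _ => 2)) q - ind (sect C (fun _ => 0)) q)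
                 + (ind (sect B (fun _ => 2)) q - ind (sect B (fun _ => 1)) q) * (ind (sect C (fun _ => 2)) q - ind (sect C (fun _ => 1)) q) )
        * lamU V q)
      ≤ sStarD A B C := by
  rw [sStarD_cylOne_eq_lamU_sub_thetaVal V hA B C, ← two_mul_sum_lamU_sub_eq_corners]
  have hBs : ∀ s : Fin 3, IsUpperSet ((sect B (fun _ : Fin 1 => s)) : Set (Pd k)) := fun s => isUpperSet_sect hB _
  have hCs : ∀ s : Fin 3, IsUpperSet ((sect C (fun _ : Fin 1 => s)) : Set (Pd k)) := fun s => isUpperSet_sect hC _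
  have g01 := sum_sum_thetaVal_le_of_good (hgood _ _ (hBs 0) (hCs 1))
  have g02 := sum_sum_thetaVal_le_of_good (hgood _ _ (hBs 0) (hCs 2))
  have g10 := sum_sum_thetaVal_le_of_good (hgood _ _ (hBs 1) (hCs 0))
  have g12 := sum_sum_thetaVal_le_of_good (hgood _ _ (hBs 1) (hCs 2))
  have g20 := sum_sum_thetaVal_le_of_good (hgood _ _ (hBs 2) (hCs 0))
  have g21 := sum_sum_thetaVal_le_of_good (hgood _ _ (hBs 2) (hCs 1))
  linarith

/-- `λ_V(q) ≥ 0` on `V`: `λ_V(q) = 2^{k+1} − ν_V(q) ≥ 2^k`. [this work] -/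
theorem lamU_nonneg_of_mem {V : Finset (Pd k)} {q : Pd k} (hq : q ∈ V) : 0 ≤ lamU V q := by
  unfold lamU
  have h1 : ind V q = 1 := by unfold ind; simp [hq]
  have h2 := nuCount_le_two_pow V q
  have h3 : (0:ℤ) ≤ 2 ^ k := by positivity
  rw [h1]; linarith

/-- Sections of an up-set are nested along the free axis: `s ≤ t`, `glue s q ∈ B` ⟹ `glue t q ∈ B`. [this work] -/
theorem mem_of_glue_mem_of_le {B : Finset (Pd (1 + k))} (hB : IsUpperSet (B : Set (Pd (1 + k)))) {s t : Fin 3} (hst : s ≤ t)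
    {q : Pd k} (h : glue (fun _ : Fin 1 => s) q ∈ B) : glue (fun _ : Fin 1 => t) q ∈ B := by
  have hle : glue (fun _ : Fin 1 => s) q ≤ glue (fun _ : Fin 1 => t) q := by
    intro a
    refine Fin.addCases (fun i => ?_) (fun j => ?_) a
    · simp only [glue, Fin.append_left]; exact hst
    · simp only [glue, Fin.append_right]; exact le_rfl
  exact hB hle h

/-- For nested sections the corner weight `(1_{B_t}−1_{B_s})(1_{C_t}−1_{C_s})` is the indicator of `(B_t∖B_s)∩(C_t∖C_s)`: it is
`0` or `1`, and it is `1` exactly when `glue t q ∈ B ∩ C` and `glue s q ∉ B`, `glue s q ∉ C`. [this work] -/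
theorem corner_term_nonneg_of_upper {V : Finset (Pd k)} {B C : Finset (Pd (1 + k))}
    (hB : IsUpperSet (B : Set (Pd (1 + k)))) (hC : IsUpperSet (C : Set (Pd (1 + k)))) {s t : Fin 3} (hst : s ≤ t)
    (hcorner : ∀ q : Pd k, glue (fun _ : Fin 1 => t) q ∈ B → glue (fun _ : Fin 1 => t) q ∈ C →
        glue (fun _ : Fin 1 => s) q ∉ B → glue (fun _ : Fin 1 => s) q ∉ C → q ∈ V)
    (q : Pd k) :
    0 ≤ (ind (sect B (fun _ => t)) q - ind (sect B (fun _ => s)) q) * (ind (sect C (fun _ => t)) q - ind (sect C (fun _ => s)) q)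
          * lamU V q := by
  simp only [ind_sect]
  have hBm := fun h => mem_of_glue_mem_of_le hB hst (q := q) h
  have hCm := fun h => mem_of_glue_mem_of_le hC hst (q := q) h
  by_cases bt : glue (fun _ : Fin 1 => t) q ∈ B
  · by_cases ct : glue (fun _ : Fin 1 => t) q ∈ C
    · by_cases bs : glue (fun _ : Fin 1 => s) q ∈ B
      · have : ind B (glue (fun _ : Fin 1 => t) q) - ind B (glue (fun _ : Fin 1 => s) q) = 0 := by unfold ind; simp [bt, bs]
        rw [this]; simp
      · by_cases cs : glue (fun _ : Fin 1 => s) q ∈ C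
        · have : ind C (glue (fun _ : Fin 1 => t) q) - ind C (glue (fun _ : Fin 1 => s) q) = 0 := by unfold ind; simp [ct, cs]
          rw [this]; simp
        · have hV := hcorner q bt ct bs cs
          have e1 : ind B (glue (fun _ : Fin 1 => t) q) - ind B (glue (fun _ : Fin 1 => s) q) = 1 := by unfold ind; simp [bt, bs]
          have e2 : ind C (glue (fun _ : Fin 1 => t) q) - ind C (glue (fun _ : Fin 1 => s) q) = 1 := by unfold ind; simp [ct, cs]
          rw [e1, e2]; simpa using lamU_nonneg_of_mem hV
    · have cs : glue (fun _ : Fin 1 => s) q ∉ C := fun h => ct (hCm h)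
      have : ind C (glue (fun _ : Fin 1 => t) q) - ind C (glue (fun _ : Fin 1 => s) q) = 0 := by unfold ind; simp [ct, cs]
      rw [this]; simp
  · have bs : glue (fun _ : Fin 1 => s) q ∉ B := fun h => bt (hBm h)
    have : ind B (glue (fun _ : Fin 1 => t) q) - ind B (glue (fun _ : Fin 1 => s) q) = 0 := by unfold ind; simp [bt, bs]
    rw [this]; simp

/-- **THE CYLINDER STEP MODULO CORNERS**: if `V` is a good first slot of `[3]^k`, `B, C ⊆ [3]^{1+k}` are up-sets, and every CORNER point
lies in `V` — whenever `glue t q ∈ B ∩ C` but `glue s q ∉ B` and `glue s q ∉ C` for some `s ≤ t`, then `q ∈ V` — then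
`0 ≤ sStarD ([3]×V) B C`.  (E.g. `B` or `C` a cylinder: no corners.)  The cylinder over a merely good `V` can only fail through the
td-shadow `ν_V` of `V` on corner points outside `V`. [this work] -/
theorem sStarD_cylOne_nonneg_of_good_of_corners {V : Finset (Pd k)}
    (hgood : ∀ P Q : Finset (Pd k), IsUpperSet (P : Set (Pd k)) → IsUpperSet (Q : Set (Pd k)) → 0 ≤ sStarD V P Q)
    {A : Finset (Pd (1 + k))} (hA : ∀ ξ z, glue ξ z ∈ A ↔ z ∈ V)
    {B C : Finset (Pd (1 + k))} (hB : IsUpperSet (B : Set (Pd (1 + k)))) (hC : IsUpperSet (C : Set (Pd (1 + k))))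
    (hcorner : ∀ (s t : Fin 3) (q : Pd k), s ≤ t → glue (fun _ : Fin 1 => t) q ∈ B → glue (fun _ : Fin 1 => t) q ∈ C →
        glue (fun _ : Fin 1 => s) q ∉ B → glue (fun _ : Fin 1 => s) q ∉ C → q ∈ V) :
    0 ≤ sStarD A B C := by
  refine le_trans ?_ (sStarD_cylOne_ge_of_good hgood hA hB hC)
  refine Finset.sum_nonneg fun q _ => ?_
  have h01 := corner_term_nonneg_of_upper (V := V) hB hC (s := 0) (t := 1) (by decide) (fun q a b c d => hcorner 0 1 q (by decide) a b c d) q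
  have h02 := corner_term_nonneg_of_upper (V := V) hB hC (s := 0) (t := 2) (by decide) (fun q a b c d => hcorner 0 2 q (by decide) a b c d) q
  have h12 := corner_term_nonneg_of_upper (V := V) hB hC (s := 1) (t := 2) (by decide) (fun q a b c d => hcorner 1 2 q (by decide) a b c d) q
  have e : ((ind (sect B (fun _ => 1)) q - ind (sect B (fun _ => 0)) q) * (ind (sect C (fun _ => 1)) q - ind (sect C (fun _ => 0)) q)
        + (ind (sect B (fun _ => 2)) q - ind (sect B (fun _ => 0)) q) * (ind (sect C (fun _ => 2)) q - ind (sect C (fun _ => 0)) q)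
        + (ind (sect B (fun _ => 2)) q - ind (sect B (fun _ => 1)) q) * (ind (sect C (fun _ => 2)) q - ind (sect C (fun _ => 1)) q)) * lamU V q
      = (ind (sect B (fun _ => 1)) q - ind (sect B (fun _ => 0)) q) * (ind (sect C (fun _ => 1)) q - ind (sect C (fun _ => 0)) q) * lamU V q
        + (ind (sect B (fun _ => 2)) q - ind (sect B (fun _ => 0)) q) * (ind (sect C (fun _ => 2)) q - ind (sect C (fun _ => 0)) q) * lamU V q
        + (ind (sect B (fun _ => 2)) q - ind (sect B (fun _ => 1)) q) * (ind (sect C (fun _ => 2)) q - ind (sect C (fun _ => 1)) q) * lamU V q := by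
    ring
  rw [e]
  linarith

end Summit.CriticalPhenomena.PercolationContinuityZ3.Theorems.SahiGridPattern
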